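import Summits.ResolutionOfSingularities.ResolutionOfSingularities.Theorems.StrictDrop.Negative.FalseWithoutFG
import Summits.ResolutionOfSingularities.ResolutionOfSingularities.Theorems.StrictDrop.Negative.FalseWithoutIsFractionRingHahn

/-!
# `StrictDrop` (crux stmt-ResolutionOfSingularities-16485, route `HomologicalConductor`):
# the hypothesis `IsFractionRing ↥A K` is load-bearing
# (negative-side support, refuter crux-disprover seat; this file does NOT refute the crux)

Companion of `FalseWithoutFG.lean`. `StrictDrop` normalises each stage INSIDE `K`; the hypothesis
`IsFractionRing ↥A K` is what makes that the normalisation of the stage. Delete it and the crux is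
FALSE (`strictDrop_false_without_isFractionRing`, stated inline, verbatim otherwise):

* witness `p = 2`, `k = 𝔽₂`, `K = 𝔽₂(t^{1/2^∞})` = the perfect closure of `𝔽₂(t)` realised as the
  intermediate field of the Hahn field `𝔽₂((t^ℚ))` generated by the `t^(1/2^e)`, `O` = the pull-back
  of the `t`-adic valuation ring (value group `ℤ[1/2]`, non-discrete), `A = 𝔽₂[t]` — finitely
  generated, `A ⊆ O`, but `Frac A = 𝔽₂(t) ≠ K`;
* mechanism (`isIntegral_loc_of_memB`, pure inseparability): every `y ∈ K` has
  `y^(2^E) · G(t) = F(t)` for polynomials `F, G` (`rep`, Frobenius); if `v(y) ≥ 0` then after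
  cancelling powers of `t` (`cancel`, `X_pow_dvd_of_le_val`) `y^(2^E) = F₁(t)/G₁(t)` with `G₁(0) ≠ 0`,
  an element of the first stage `loc O A`; so `y` is INTEGRAL over the first stage and the
  normalisation in `K` swallows all of `O`: the second stage is `O` itself, a valuation ring fixed by
  `loc`, `chart`, `nrm` (`B_fixed`), i.e. the tower is frozen at `T₁ = O` from stage `1` on
  (`natRec_eq_from_one`), and `O` is not noetherian (`not_isRegularLocalRing_B`: the ideals
  `(t^(1/2^n))` increase strictly), so `natRec_not_drop` (a frozen non-regular stage violates the
  drop conclusion, `not_drop_of_frozen` of the companion file at `n = 1`) closes.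

Moral for provers: finite NORMALISATION (the lead's `stub_towerShape`) needs `K = Frac A` exactly as
much as it needs `A.FG`; with `K ⊋ Frac A` algebraic the tower leaves the noetherian world at the
first normalisation. Implementation: as in the companion file no definition is added under
`Summits/`; the route's `let`-bound tower is matched by higher-order pattern unification against
abstract `Nat.rec` lemmas and otherwise spelled out.
-/

noncomputable section
open Polynomial

-- single-problem summit: the doubled namespace component `ResolutionOfSingularities` is forced
set_option linter.dupNamespace false

namespace Summit.ResolutionOfSingularities.ResolutionOfSingularities.Theorems.StrictDrop.Negative

/-! ## More abstract / general tower lemmas -/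

section Abstract2

/-- A `Nat.rec` tower whose first step lands on a fixed point `a` of the step is `a` from stage
`1` on. [folklore] -/
theorem natRec_eq_from_one {α : Type} (a T0 : α) (step : α → α) (h1 : step T0 = a)
    (hstep : step a = a) : ∀ m : ℕ, 1 ≤ m → @Nat.rec (fun _ => α) T0 (fun _ B => step B) m = a := by
  intro m hm
  obtain ⟨d, rfl⟩ := Nat.exists_eq_add_of_le' hm
  induction d with
  | zero => exact h1
  | succ d ih =>
    show step (@Nat.rec (fun _ => α) T0 (fun _ B => step B) (d + 1)) = a
    rw [ih (Nat.le_add_left 1 d), hstep]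

end Abstract2

section Steps2

variable {k K : Type} [Field k] [Field K] [Algebra k K]

/-- `X ⊆ chart O X`. [folklore] -/
theorem le_chart (O : ValuationSubring K) (X : Subalgebra k K) : X ≤ (Algebra.adjoin k ((X : Set _) ∪ {y | ∃ c ∈ {x | ∃ hx : x ∈ X, ∃ n : ℕ, ∀ i : ℕ, n ≤ i → ∀ (M N : ModuleCat.{0} ↥X), Module.Finite ↥X M → Module.Finite ↥X N → ∀ e : CategoryTheory.Abelian.Ext.{0} M N i, (⟨x, hx⟩ : ↥X) • e = 0}, ∃ x ∈ {x | ∃ hx : x ∈ X, ∃ n : ℕ, ∀ i : ℕ, n ≤ i → ∀ (M N : ModuleCat.{0} ↥X), Module.Finite ↥X M → Module.Finite ↥X N → ∀ e : CategoryTheory.Abelian.Ext.{0} M N i, (⟨x, hx⟩ : ↥X) • e = 0}, x ≠ 0 ∧ (∀ c' ∈ {x | ∃ hx : x ∈ X, ∃ n : ℕ, ∀ i : ℕ, n ≤ i → ∀ (M N : ModuleCat.{0} ↥X), Module.Finite ↥X M → Module.Finite ↥X N → ∀ e : CategoryTheory.Abelian.Ext.{0} M N i, (⟨x, hx⟩ :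 ↥X) • e = 0}, c' * x⁻¹ ∈ O) ∧ y = c * x⁻¹})) :=
  fun _ ha => Algebra.subset_adjoin (Or.inl ha)

/-- `X ⊆ loc O X`. [folklore] -/
theorem le_loc (O : ValuationSubring K) (X : Subalgebra k K) : X ≤ (Algebra.adjoin k {y | ∃ a ∈ X, ∃ s ∈ X, s⁻¹ ∈ O ∧ y = a * s⁻¹}) :=
  fun a ha => Algebra.subset_adjoin ⟨a, ha, 1, X.one_mem, by simp, by simp⟩

/-- `loc O X ⊆ B` when `X ⊆ B ⊇ O`. [folklore] -/
theorem loc_le_of_le (O : ValuationSubring K) {X B : Subalgebra k K} (hXB : X ≤ B)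
    (hOB : ∀ y ∈ O, y ∈ B) : (Algebra.adjoin k {y | ∃ a ∈ X, ∃ s ∈ X, s⁻¹ ∈ O ∧ y = a * s⁻¹}) ≤ B := by
  refine Algebra.adjoin_le ?_
  rintro y ⟨a, ha, s, _, hsO, rfl⟩
  exact B.mul_mem (hXB ha) (hOB _ hsO)

/-- `chart O X ⊆ B` when `X ⊆ B ⊇ O`. [folklore] -/
theorem chart_le_of_le (O : ValuationSubring K) {X B : Subalgebra k K} (hXB : X ≤ B)
    (hOB : ∀ y ∈ O, y ∈ B) : (Algebra.adjoin k ((X : Set _) ∪ {y | ∃ c ∈ {x | ∃ hx : x ∈ X, ∃ n : ℕ, ∀ i : ℕ, n ≤ i → ∀ (M N : ModuleCat.{0} ↥X), Module.Finite ↥X M → Module.Finite ↥X N → ∀ e : CategoryTheory.Abelian.Ext.{0} M N i, (⟨x, hx⟩ : ↥X) • e = 0}, ∃ x ∈ {x | ∃ hx : x ∈ X, ∃ n : ℕ, ∀ i : ℕ, n ≤ i → ∀ (M N : ModuleCat.{0} ↥X), Module.Finite ↥X M → Module.Finite ↥X N → ∀ e : CategoryTheory.Abelian.Ext.{0} M N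 i, (⟨x, hx⟩ : ↥X) • e = 0}, x ≠ 0 ∧ (∀ c' ∈ {x | ∃ hx : x ∈ X, ∃ n : ℕ, ∀ i : ℕ, n ≤ i → ∀ (M N : ModuleCat.{0} ↥X), Module.Finite ↥X M → Module.Finite ↥X N → ∀ e : CategoryTheory.Abelian.Ext.{0} M N i, (⟨x, hx⟩ : ↥X) • e = 0}, c' * x⁻¹ ∈ O) ∧ y = c * x⁻¹})) ≤ B := by
  refine Algebra.adjoin_le ?_
  rintro y (hy | ⟨c, hc, x, _, _, hxmin, rfl⟩)
  · exact hXB hy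
  · exact hOB _ (hxmin c hc)

/-- `nrm X ⊆ B` when `X ⊆ B` and `B` is integrally closed in `K`. [folklore] -/
theorem nrm_le_of_le {X B : Subalgebra k K} (hXB : X ≤ B)
    (hint : ∀ y : K, IsIntegral ↥B y → y ∈ B) : (Algebra.adjoin k {y | IsIntegral ↥X y}) ≤ B :=
  Algebra.adjoin_le fun y hy => hint y
    (hy.map_of_comp_eq (Subalgebra.inclusion hXB).toRingHom (RingHom.id K) (RingHom.ext fun _ => rfl))

/-- **Closing lemma, abstract form.** A `Nat.rec` tower `T_(m+1) = step (T_m)` whose first step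
lands on a fixed point `B` of `step` that is not a regular local ring violates the drop conclusion
(stated over the `Nat.rec` so that the route's own tower is matched by higher-order pattern
unification, never restated). [folklore] -/
theorem natRec_not_drop (O : ValuationSubring K) (T0 : Subalgebra k K)
    (step : Subalgebra k K → Subalgebra k K) (B : Subalgebra k K) (h1 : step T0 = B)
    (hstep : step B = B) (hsing : ¬ IsRegularLocalRing ↥B)
    (key : ∀ m : ℕ, ¬ IsRegularLocalRing ↥(@Nat.rec (fun _ => Subalgebra k K) T0 (fun _ X => step X) m) →
      ∃ m' : ℕ, m < m' ∧
        ∃ y ∈ {x | ∃ hx : x ∈ (@Nat.rec (fun _ => Subalgebra k K) T0 (fun _ X => step X) m'), ∃ n : ℕ, ∀ i : ℕ, n ≤ i → ∀ (M N : ModuleCat.{0} ↥(@Nat.rec (fun _ => Subalgebra k K) T0 (fun _ X => step X) m')), Module.Finite ↥(@Nat.rec (fun _ => Subalgebra k K) T0 (fun _ X => step X) m') M → Module.Finite ↥(@Nat.rec (fun _ => Subalgebra k K) T0 (fun _ X => step X) m') N → ∀ e : CategoryTheory.Abelian.Ext.{0} M N i, (⟨x, hx⟩ : ↥(@Nat.rec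 (fun _ => Subalgebra k K) T0 (fun _ X => step X) m')) • e = 0}, y ≠ 0 ∧
          ∀ x ∈ {x | ∃ hx : x ∈ (@Nat.rec (fun _ => Subalgebra k K) T0 (fun _ X => step X) m), ∃ n : ℕ, ∀ i : ℕ, n ≤ i → ∀ (M N : ModuleCat.{0} ↥(@Nat.rec (fun _ => Subalgebra k K) T0 (fun _ X => step X) m)), Module.Finite ↥(@Nat.rec (fun _ => Subalgebra k K) T0 (fun _ X => step X) m) M → Module.Finite ↥(@Nat.rec (fun _ => Subalgebra k K) T0 (fun _ X => step X) m) N → ∀ e : CategoryTheory.Abelian.Ext.{0} M N i, (⟨x, hx⟩ : ↥(@Nat.rec (fun _ => Subalgebra k K) T0 (fun _ X => step X) m)) • e = 0}, x ≠ 0 → y * x⁻¹ ∉ O) :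
    False := by
  have hTB := natRec_eq_from_one B T0 step h1 hstep
  refine not_drop_of_frozen (fun m => @Nat.rec (fun _ => Subalgebra k K) T0 (fun _ X => step X) m) O
    (n := 1) (fun m hm => (hTB m hm).trans (hTB 1 le_rfl).symm) ?_ key
  show ¬ IsRegularLocalRing ↥(@Nat.rec (fun _ => Subalgebra k K) T0 (fun _ X => step X) 1)
  rw [hTB 1 le_rfl]
  exact hsing

end Steps2

/-! ## The witness: the perfect closure of `𝔽₂(t)` inside `𝔽₂((t^ℚ))` -/

section Witness2

section KZero

variable {K' : Type} [Field K'] [Algebra (ZMod 2) K'] (ι : K' →ₐ[ZMod 2] (HahnSeries ℚ (ZMod 2)))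
variable (O₀ : ValuationSubring K') (hO : ∀ y : K', y ∈ O₀ ↔ 0 ≤ (HahnSeries.addVal ℚ (ZMod 2)) (ι y))
variable (B : Subalgebra (ZMod 2) K') (hB : ∀ y, y ∈ B ↔ y ∈ O₀)
variable (T' : K') (hT' : ι T' = (HahnSeries.single (1 : ℚ) (1 : ZMod 2) : HahnSeries ℚ (ZMod 2)))
variable (A : Subalgebra (ZMod 2) K') (hAB : A ≤ B) (hTA : ∀ P : (ZMod 2)[X], aeval T' P ∈ A)

include hO hB

/-- `B = O₀` is a ring of integers of the valuation pulled back along `ι`. [folklore] -/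
theorem integersB :
    (((AddValuation.toValuation (HahnSeries.addVal ℚ (ZMod 2))).comap ι.toRingHom)).Integers ↥B where
  hom_inj := Subtype.coe_injective
  map_le_one := fun r => (hO _).mp ((hB _).mp r.2)
  exists_of_le_one := fun r hr => ⟨⟨r, (hB _).mpr ((hO _).mpr hr)⟩, rfl⟩

/-- `B = O₀` is integrally closed in `K'`. [folklore] -/
theorem memB_of_isIntegral {y : K'} (hy : IsIntegral ↥B y) : y ∈ B :=
  (hB _).mpr ((hO _).mpr ((integersB ι O₀ hO B hB).mem_of_integral hy))

/-- The three steps fix `B = O₀`. [folklore] -/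
theorem B_fixed : (Algebra.adjoin (ZMod 2) {y | ∃ a ∈ B, ∃ s ∈ B, s⁻¹ ∈ O₀ ∧ y = a * s⁻¹}) = B ∧ (Algebra.adjoin (ZMod 2) ((B : Set _) ∪ {y | ∃ c ∈ {x | ∃ hx : x ∈ B, ∃ n : ℕ, ∀ i : ℕ, n ≤ i → ∀ (M N : ModuleCat.{0} ↥B), Module.Finite ↥B M → Module.Finite ↥B N → ∀ e : CategoryTheory.Abelian.Ext.{0} M N i, (⟨x, hx⟩ : ↥B) • e = 0}, ∃ x ∈ {x | ∃ hx : x ∈ B, ∃ n : ℕ, ∀ i : ℕ, n ≤ i → ∀ (M N : ModuleCat.{0} ↥B), Module.Finite ↥B M → Module.Finite ↥B N → ∀ e : CategoryTheory.Abelian.Ext.{0} M N i, (⟨x, hx⟩ : ↥B) • e = 0}, x ≠ 0 ∧ (∀ c' ∈ {x | ∃ hx : x ∈ B, ∃ n : ℕ, ∀ i : ℕ, n ≤ i → ∀ (M N : ModuleCat.{0} ↥B), Module.Finite ↥B M → Module.Finite ↥B N → ∀ e : CategoryTheory.Abelian.Ext.{0} M N i, (⟨x, hx⟩ : ↥B)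 • e = 0}, c' * x⁻¹ ∈ O₀) ∧ y = c * x⁻¹})) = B ∧ (Algebra.adjoin (ZMod 2) {y | IsIntegral ↥B y}) = B :=
  ⟨loc_eq_self O₀ B (fun x hx => (hB x).mp hx) (fun _ _ hs => (hB _).mpr hs),
    chart_eq_self O₀ B (fun x hx => (hB x).mpr hx),
    nrm_eq_self B (fun _ hy => memB_of_isIntegral ι O₀ hO B hB hy)⟩

include hT' hTA

/-- Frobenius integrality: every element of `B = O₀` is integral over `loc O₀ 𝔽₂[T]`, provided every
element of `K'` has a `2^E`-th power in `𝔽₂(T)`. [folklore] -/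
theorem isIntegral_loc_of_memB
    (hrep : ∀ y : K', ∃ (E : ℕ) (F G : (ZMod 2)[X]), aeval (HahnSeries.single (1 : ℚ) (1 : ZMod 2) : HahnSeries ℚ (ZMod 2)) G ≠ 0 ∧
      ι y ^ (2 ^ E) * aeval (HahnSeries.single (1 : ℚ) (1 : ZMod 2) : HahnSeries ℚ (ZMod 2)) G = aeval (HahnSeries.single (1 : ℚ) (1 : ZMod 2) : HahnSeries ℚ (ZMod 2)) F)
    {y : K'} (hy : y ∈ B) :
    IsIntegral ↥((Algebra.adjoin (ZMod 2) {y | ∃ a ∈ A, ∃ s ∈ A, s⁻¹ ∈ O₀ ∧ y = a * s⁻¹})) y := by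
  obtain ⟨E, F, G, hG, h⟩ := hrep y
  have hvy : 0 ≤ (HahnSeries.addVal ℚ (ZMod 2)) (ι y ^ 2 ^ E) := by
    rw [AddValuation.map_pow]; exact nsmul_nonneg ((hO _).mp ((hB _).mp hy)) _
  obtain ⟨F₁, G₁, hvG₁, hG₁, h₁⟩ := cancel hvy hG h
  have hcoe : ∀ P : (ZMod 2)[X], ι (aeval T' P) = aeval (HahnSeries.single (1 : ℚ) (1 : ZMod 2) : HahnSeries ℚ (ZMod 2)) P := by
    intro P; rw [← hT', Polynomial.aeval_algHom_apply]
  have hι : Function.Injective ι := ι.toRingHom.injective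
  have hG₁' : (aeval T' G₁ : K') ≠ 0 := by
    intro h0; apply hG₁; rw [← hcoe, h0, map_zero]
  have hrel : y ^ 2 ^ E * aeval T' G₁ = aeval T' F₁ := by
    apply hι
    rw [map_mul, map_pow, hcoe, hcoe]
    exact h₁
  have hz : y ^ 2 ^ E = aeval T' F₁ * (aeval T' G₁)⁻¹ := by
    rw [← hrel, mul_inv_cancel_right₀ hG₁']
  have hinvO : (aeval T' G₁ : K')⁻¹ ∈ O₀ := by
    refine (hO _).mpr ?_
    rw [map_inv₀, AddValuation.map_inv, hcoe, hvG₁, neg_zero]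
  have hzmem : y ^ 2 ^ E ∈ (Algebra.adjoin (ZMod 2) {y | ∃ a ∈ A, ∃ s ∈ A, s⁻¹ ∈ O₀ ∧ y = a * s⁻¹}) :=
    Algebra.subset_adjoin ⟨aeval T' F₁, hTA F₁, aeval T' G₁, hTA G₁, hinvO, hz⟩
  refine IsIntegral.of_pow (pow_pos two_pos E) ?_
  have : y ^ 2 ^ E = algebraMap ↥((Algebra.adjoin (ZMod 2) {y | ∃ a ∈ A, ∃ s ∈ A, s⁻¹ ∈ O₀ ∧ y = a * s⁻¹})) K' ⟨y ^ 2 ^ E, hzmem⟩ := rfl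
  rw [this]
  exact isIntegral_algebraMap

omit hT' hTA in
/-- `B = O₀` is not a regular local ring — it is not even noetherian (the ideals `(t^(1/2^n))`
increase strictly) — provided `K'` contains all `t^(1/2^n)`. [folklore] -/
theorem not_isRegularLocalRing_B
    (hs : ∀ e : ℕ, ∃ s : K', ι s = HahnSeries.single ((1 : ℚ) / 2 ^ e) (1 : ZMod 2)) :
    ¬ IsRegularLocalRing ↥B := by
  intro hreg
  have hN : IsNoetherianRing ↥B := inferInstance
  have hι : Function.Injective ι := ι.toRingHom.injective
  choose s hs using hs
  have hsB : ∀ n, s n ∈ B := fun n => (hB _).mpr ((hO _).mpr (by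
    rw [hs n, HahnSeries.addVal_apply]
    exact (WithTop.coe_le_coe.mpr (by positivity)).trans HahnSeries.orderTop_single_le))
  let t : ℕ → ↥B := fun n => ⟨s n, hsB n⟩
  have ht : ∀ n, t (n + 1) * t (n + 1) = t n := by
    intro n
    apply Subtype.ext
    apply hι
    show ι (s (n + 1) * s (n + 1)) = ι (s n)
    have hq : (1 : ℚ) / 2 ^ (n + 1) + 1 / 2 ^ (n + 1) = 1 / 2 ^ n := by
      rw [pow_succ]; field_simp; norm_num
    rw [map_mul, hs, hs, HahnSeries.single_mul_single, mul_one, hq]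
  let chain : ℕ →o Ideal ↥B :=
    ⟨fun n => Ideal.span {t n}, monotone_nat_of_le_succ fun n =>
      Ideal.span_singleton_le_span_singleton.mpr ⟨t (n + 1), (ht n).symm⟩⟩
  obtain ⟨n, hn⟩ := (monotone_stabilizes_iff_noetherian.mpr hN) chain
  have hmem : t (n + 1) ∈ Ideal.span {t n} := by
    have : chain n = chain (n + 1) := hn (n + 1) (Nat.le_succ n)
    change t (n + 1) ∈ chain n
    rw [this]
    exact Ideal.subset_span rfl
  obtain ⟨g, hg⟩ := Ideal.mem_span_singleton'.mp hmem
  have hgK : ι (g : K') * HahnSeries.single ((1 : ℚ) / 2 ^ n) 1 =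
      HahnSeries.single ((1 : ℚ) / 2 ^ (n + 1)) 1 := by
    have := congr_arg (fun b : ↥B => ι (b : K')) hg
    simpa only [Subalgebra.coe_mul, map_mul, t, hs] using this
  have hg0 : ι (g : K') ≠ 0 := by
    intro h0
    rw [h0, zero_mul] at hgK
    exact HahnSeries.single_ne_zero one_ne_zero hgK.symm
  have hord := congr_arg HahnSeries.order hgK
  rw [HahnSeries.order_mul hg0 (HahnSeries.single_ne_zero one_ne_zero),
    HahnSeries.order_single one_ne_zero, HahnSeries.order_single one_ne_zero] at hord
  have hgv : 0 ≤ (ι (g : K')).order := by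
    have := (hO _).mp ((hB _).mp g.2)
    rw [HahnSeries.addVal_apply, ← HahnSeries.order_eq_orderTop_of_ne_zero hg0,
      ← WithTop.coe_zero, WithTop.coe_le_coe] at this
    exact this
  have hlt : (1 : ℚ) / 2 ^ (n + 1) < 1 / 2 ^ n := by
    apply one_div_lt_one_div_of_lt (by positivity)
    exact pow_lt_pow_right₀ (by norm_num) (Nat.lt_succ_self n)
  linarith

include hAB in
/-- The abstract kill: any `𝔽₂`-field `K'` embedded in `𝔽₂((t^ℚ))` by `ι`, containing `T = t` and all
`t^(1/2^e)`, all of whose elements have a `2^E`-th power in `𝔽₂(t)`, refutes the crux without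
`IsFractionRing` at `(O, A) = (ι⁻¹ O, 𝔽₂[T])`: the tower is frozen at the non-noetherian `O` from
stage `1` on. [folklore] -/
theorem not_strictDropWithoutIsFractionRing_of (hfg : A.FG)
    (hs : ∀ e : ℕ, ∃ s : K', ι s = HahnSeries.single ((1 : ℚ) / 2 ^ e) (1 : ZMod 2))
    (hrep : ∀ y : K', ∃ (E : ℕ) (F G : (ZMod 2)[X]), aeval (HahnSeries.single (1 : ℚ) (1 : ZMod 2) : HahnSeries ℚ (ZMod 2)) G ≠ 0 ∧
      ι y ^ (2 ^ E) * aeval (HahnSeries.single (1 : ℚ) (1 : ZMod 2) : HahnSeries ℚ (ZMod 2)) G = aeval (HahnSeries.single (1 : ℚ) (1 : ZMod 2) : HahnSeries ℚ (ZMod 2)) F)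
    (h : ∀ p : ℕ, p.Prime → ∀ (k K : Type) [Field k] [CharP k p] [Field K] [Algebra k K] (O : ValuationSubring K) (A : Subalgebra k K), (∀ c : k, algebraMap k K c ∈ O) → A.FG → A.toSubring ≤ O.toSubring → let ca : Subalgebra k K → Set K := fun A => {x : K | ∃ hx : x ∈ A, ∃ n : ℕ, ∀ i : ℕ, n ≤ i → ∀ (M N : ModuleCat.{0} ↥A), Module.Finite ↥A M → Module.Finite ↥A N → ∀ e : CategoryTheory.Abelian.Ext.{0} M N i, (⟨x, hx⟩ : ↥A) • e = 0}; let loc : Subalgebra k K → Subalgebra k K := fun A => Algebra.adjoin k {y : K | ∃ a ∈ A, ∃ s ∈ A, s⁻¹ ∈ O ∧ y = a * s⁻¹}; let chart : Subalgebra k K → Subalgebra k K := fun A => Algebra.adjoin k ((A : Set K) ∪ {y : K | ∃ c ∈ ca A, ∃ x ∈ ca A, x ≠ 0 ∧ (∀ c' ∈ ca A, c' * x⁻¹ ∈ O) ∧ y = c * x⁻¹}); let nrm : Subalgebra k K → Subalgebra k K := fun B => Algebra.adjoin k {y : K | IsIntegral ↥B y}; let tower : Subalgebra k K → ℕ → Subalgebra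 k K := fun A m => @Nat.rec (fun _ => Subalgebra k K) (loc A) (fun _ B => loc (nrm (chart B))) m; ∀ m : ℕ, ¬ IsRegularLocalRing ↥(tower A m) → ∃ m' : ℕ, m < m' ∧ ∃ y ∈ ca (tower A m'), y ≠ 0 ∧ ∀ x ∈ ca (tower A m), x ≠ 0 → y * x⁻¹ ∉ O) : False := by
  have hk : ∀ c : ZMod 2, algebraMap (ZMod 2) K' c ∈ O₀ := by
    intro c
    refine (hO _).mpr ?_
    rw [AlgHom.commutes]
    exact (mem_O_iff).mp (algebraMap_mem_O c)
  have hle : A.toSubring ≤ O₀.toSubring := fun x hx => (hB x).mp (hAB hx)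
  obtain ⟨hloc, hchart, hnrm⟩ := B_fixed ι O₀ hO B hB
  have hOB : ∀ y ∈ O₀, y ∈ B := fun y hy => (hB y).mpr hy
  have hintB : ∀ y : K', IsIntegral ↥B y → y ∈ B := fun _ hy => memB_of_isIntegral ι O₀ hO B hB hy
  refine natRec_not_drop O₀ _ _ B ?_ ?_ (not_isRegularLocalRing_B ι O₀ hO B hB hs)
    (h 2 Nat.prime_two (ZMod 2) K' O₀ A hk hfg hle)
  · refine le_antisymm ?_ ?_
    · exact loc_le_of_le O₀ (nrm_le_of_le (chart_le_of_le O₀ (loc_le_of_le O₀ hAB hOB) hOB) hintB) hOB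
    · intro y hy
      exact le_loc O₀ _ (Algebra.subset_adjoin
        ((isIntegral_loc_of_memB ι O₀ hO B hB T' hT' A hTA hrep hy).map_of_comp_eq
          (Subalgebra.inclusion (le_chart O₀ _)).toRingHom (RingHom.id K')
          (RingHom.ext fun _ => rfl)))
  · show (Algebra.adjoin (ZMod 2) {y | ∃ a ∈ (Algebra.adjoin (ZMod 2) {y | IsIntegral ↥(Algebra.adjoin (ZMod 2) ((B : Set _) ∪ {y | ∃ c ∈ {x | ∃ hx : x ∈ B, ∃ n : ℕ, ∀ i : ℕ, n ≤ i → ∀ (M N : ModuleCat.{0} ↥B), Module.Finite ↥B M → Module.Finite ↥B N → ∀ e : CategoryTheory.Abelian.Ext.{0} M N i, (⟨x, hx⟩ : ↥B) • e = 0}, ∃ x ∈ {x | ∃ hx : x ∈ B, ∃ n : ℕ, ∀ i : ℕ, n ≤ i → ∀ (M N : ModuleCat.{0} ↥B), Module.Finite ↥B M → Module.Finite ↥B N → ∀ e : CategoryTheory.Abelian.Ext.{0} M N i, (⟨x, hx⟩ : ↥B) • e = 0}, x ≠ 0 ∧ (∀ c' ∈ {x | ∃ hx : x ∈ B, ∃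 n : ℕ, ∀ i : ℕ, n ≤ i → ∀ (M N : ModuleCat.{0} ↥B), Module.Finite ↥B M → Module.Finite ↥B N → ∀ e : CategoryTheory.Abelian.Ext.{0} M N i, (⟨x, hx⟩ : ↥B) • e = 0}, c' * x⁻¹ ∈ O₀) ∧ y = c * x⁻¹})) y}), ∃ s ∈ (Algebra.adjoin (ZMod 2) {y | IsIntegral ↥(Algebra.adjoin (ZMod 2) ((B : Set _) ∪ {y | ∃ c ∈ {x | ∃ hx : x ∈ B, ∃ n : ℕ, ∀ i : ℕ, n ≤ i → ∀ (M N : ModuleCat.{0} ↥B), Module.Finite ↥B M → Module.Finite ↥B N → ∀ e : CategoryTheory.Abelian.Ext.{0} M N i, (⟨x, hx⟩ : ↥B) • e = 0}, ∃ x ∈ {x | ∃ hx : x ∈ B, ∃ n : ℕ, ∀ i : ℕ, n ≤ i → ∀ (M N : ModuleCat.{0} ↥B), Module.Finite ↥B M → Module.Finite ↥B N → ∀ e : CategoryTheory.Abelian.Ext.{0} M N i, (⟨x, hx⟩ : ↥B) • e = 0}, x ≠ 0 ∧ (∀ c' ∈ {x | ∃ hx : x ∈ B, ∃ n : ℕ,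 ∀ i : ℕ, n ≤ i → ∀ (M N : ModuleCat.{0} ↥B), Module.Finite ↥B M → Module.Finite ↥B N → ∀ e : CategoryTheory.Abelian.Ext.{0} M N i, (⟨x, hx⟩ : ↥B) • e = 0}, c' * x⁻¹ ∈ O₀) ∧ y = c * x⁻¹})) y}), s⁻¹ ∈ O₀ ∧ y = a * s⁻¹}) = B
    rw [hchart, hnrm, hloc]

end KZero


/-! ## The negative lemma for `IsFractionRing` -/

/-- **Any proof of `StrictDrop` must use `IsFractionRing ↥A K`.** The statement below is VERBATIM
the crux `HomologicalConductor.StrictDrop` with the single hypothesis `IsFractionRing ↥A K →`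
deleted, and it is false: witness `p = 2`, `k = 𝔽₂`, `K = 𝔽₂(t^{1/2^∞})` (the perfect closure of
`𝔽₂(t)`, realised inside the Hahn field `𝔽₂((t^ℚ))`), `O` = its `t`-adic valuation ring (value
group `ℤ[1/2]`), `A = 𝔽₂[t]` (finitely generated, inside `O`, but `Frac A = 𝔽₂(t) ≠ K`). Every
`y ∈ O` has `y^(2^E) ∈ 𝔽₂(t) ∩ O ⊆ loc O A` (pure inseparability), so `y` is integral over the
first stage and the normalisation IN `K` swallows all of `O`: the tower is frozen at `T₁ = O`, which
is not noetherian, and `not_drop_of_frozen` applies at `n = 1`. [folklore] -/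
theorem strictDrop_false_without_isFractionRing : ¬ (
    ∀ p : ℕ, p.Prime → ∀ (k K : Type) [Field k] [CharP k p] [Field K] [Algebra k K] (O : ValuationSubring K) (A : Subalgebra k K), (∀ c : k, algebraMap k K c ∈ O) → A.FG → A.toSubring ≤ O.toSubring → let ca : Subalgebra k K → Set K := fun A => {x : K | ∃ hx : x ∈ A, ∃ n : ℕ, ∀ i : ℕ, n ≤ i → ∀ (M N : ModuleCat.{0} ↥A), Module.Finite ↥A M → Module.Finite ↥A N → ∀ e : CategoryTheory.Abelian.Ext.{0} M N i, (⟨x, hx⟩ : ↥A) • e = 0}; let loc : Subalgebra k K → Subalgebra k K := fun A => Algebra.adjoin k {y : K | ∃ a ∈ A, ∃ s ∈ A, s⁻¹ ∈ O ∧ y = a * s⁻¹}; let chart : Subalgebra k K → Subalgebra k K := fun A => Algebra.adjoin k ((A : Set K) ∪ {y : K | ∃ c ∈ ca A, ∃ x ∈ ca A, x ≠ 0 ∧ (∀ c' ∈ ca A, c' * x⁻¹ ∈ O) ∧ y = c * x⁻¹}); let nrm : Subalgebra k K → Subalgebra k K := fun B => Algebra.adjoin k {y : K | IsIntegral ↥B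 y}; let tower : Subalgebra k K → ℕ → Subalgebra k K := fun A m => @Nat.rec (fun _ => Subalgebra k K) (loc A) (fun _ B => loc (nrm (chart B))) m; ∀ m : ℕ, ¬ IsRegularLocalRing ↥(tower A m) → ∃ m' : ℕ, m < m' ∧ ∃ y ∈ ca (tower A m'), y ≠ 0 ∧ ∀ x ∈ ca (tower A m), x ≠ 0 → y * x⁻¹ ∉ O) := by
  intro h
  let K₀ : IntermediateField (ZMod 2) (HahnSeries ℚ (ZMod 2)) :=
    IntermediateField.adjoin (ZMod 2) (Set.range fun e : ℕ => HahnSeries.single ((1 : ℚ) / 2 ^ e) (1 : ZMod 2))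
  let ι : ↥K₀ →ₐ[ZMod 2] (HahnSeries ℚ (ZMod 2)) := K₀.val
  let O₀ : ValuationSubring ↥K₀ := ((AddValuation.toValuation (HahnSeries.addVal ℚ (ZMod 2))).comap ι.toRingHom).valuationSubring
  have hO : ∀ y : ↥K₀, y ∈ O₀ ↔ 0 ≤ (HahnSeries.addVal ℚ (ZMod 2)) (ι y) := fun _ => Iff.rfl
  have hk : ∀ c : ZMod 2, algebraMap (ZMod 2) ↥K₀ c ∈ O₀ := by
    intro c
    refine (hO _).mpr ?_
    rw [AlgHom.commutes]
    exact (mem_O_iff).mp (algebraMap_mem_O c)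
  obtain ⟨B, hB⟩ : ∃ B : Subalgebra (ZMod 2) ↥K₀, ∀ y, y ∈ B ↔ y ∈ O₀ :=
    ⟨{ O₀.toSubring with algebraMap_mem' := hk }, fun _ => Iff.rfl⟩
  have hT : ((HahnSeries.single (1 : ℚ) (1 : ZMod 2) : HahnSeries ℚ (ZMod 2))) ∈ K₀ := IntermediateField.subset_adjoin _ _ ⟨0, by simp⟩
  have hs : ∀ e : ℕ, ∃ s : ↥K₀, ι s = HahnSeries.single ((1 : ℚ) / 2 ^ e) (1 : ZMod 2) :=
    fun e => ⟨⟨_, IntermediateField.subset_adjoin _ _ ⟨e, rfl⟩⟩, rfl⟩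
  have hrep : ∀ y : ↥K₀, ∃ (E : ℕ) (F G : (ZMod 2)[X]), aeval (HahnSeries.single (1 : ℚ) (1 : ZMod 2) : HahnSeries ℚ (ZMod 2)) G ≠ 0 ∧
      ι y ^ (2 ^ E) * aeval (HahnSeries.single (1 : ℚ) (1 : ZMod 2) : HahnSeries ℚ (ZMod 2)) G = aeval (HahnSeries.single (1 : ℚ) (1 : ZMod 2) : HahnSeries ℚ (ZMod 2)) F := fun y => rep y.2
  have hAB : Algebra.adjoin (ZMod 2) {(⟨(HahnSeries.single (1 : ℚ) (1 : ZMod 2) : HahnSeries ℚ (ZMod 2)), hT⟩ : ↥K₀)} ≤ B := by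
    refine Algebra.adjoin_le (Set.singleton_subset_iff.mpr ((hB _).mpr ((hO _).mpr ?_)))
    show 0 ≤ (HahnSeries.addVal ℚ (ZMod 2)) (HahnSeries.single (1 : ℚ) (1 : ZMod 2) : HahnSeries ℚ (ZMod 2))
    rw [v_T]; exact zero_le_one
  exact not_strictDropWithoutIsFractionRing_of ι O₀ hO B hB ⟨(HahnSeries.single (1 : ℚ) (1 : ZMod 2) : HahnSeries ℚ (ZMod 2)), hT⟩ rfl
    (Algebra.adjoin (ZMod 2) {(⟨(HahnSeries.single (1 : ℚ) (1 : ZMod 2) : HahnSeries ℚ (ZMod 2)), hT⟩ : ↥K₀)}) hAB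
    (fun P => Polynomial.aeval_mem_adjoin_singleton (ZMod 2) _)
    ⟨{⟨(HahnSeries.single (1 : ℚ) (1 : ZMod 2) : HahnSeries ℚ (ZMod 2)), hT⟩}, by rw [Finset.coe_singleton]⟩ hs hrep h

end Witness2

end Summit.ResolutionOfSingularities.ResolutionOfSingularities.Theorems.StrictDrop.Negative
end
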